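import Mathlib
import Literature.Analysis.ValidatedNumerics.WeightedEllOneBanach
import HarnessLib

/-!
# Multiplication operators and the quadratic map on weighted `ℓ¹` as bounded (bi)linear maps

Sibling of `…ValidatedNumerics.WeightedEllOneBanach` (the `ℓ¹_ω` Banach/CLM bridge): the kernel
product `a ⋆_κ b` of `…WeightedEllOneSequenceAlgebra` (`kmul κ`, Banach-algebra constant `C` from
`KerBound ω κ C`) read as operators on Mathlib's `ℓ¹(ι, ℝ)` — multiplication by a fixed
`c ∈ ℓ¹_ω` is a KERNEL operator with weighted column bound `C ‖c‖_ω`, the product is a bounded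
bilinear map `kmulCLM` with `‖kmulCLM‖ ≤ C`, and the quadratic map `x ↦ x ⋆_κ x` has the Fréchet
derivative `h ↦ x̄ ⋆ h + h ⋆ x̄` with the Lipschitz bound `‖B b − B x̄‖ ≤ C ‖b − x̄‖` — the `hZ₂`
ingredient of the degree-2 radii-polynomial closings (`QuadraticCert.sound`,
`RadiiPolynomialTwoRadii`) for a quadratic nonlinearity on `ℓ¹_ω`.

## Source and verbatim statements

* [HungriaLessardMirelesJames2016] A. Hungria, J.-P. Lessard, J. D. Mireles James, Math. Comp. 85
  (2016) 1427–1459, doi:10.1090/mcom/3046 (held `paper:doi-10-1090-mcom-3046`, re-read 2026-08-27).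
  - §2.1, p. 1433: "`ℓ¹_ν` is a Banach space and moreover has the property of being a Banach
    algebra under discrete convolution"; "More explicitly, if `ν ≥ 1` and `a, b ∈ ℓ¹_ν`, then
    `a ∗ b ∈ ℓ¹_ν` and `‖a ∗ b‖_ν ≤ ‖a‖_ν ‖b‖_ν`."
  - Corollary 1, p. 1434: "`A ∈ B(ℓ¹_ν, ℓ¹_ν)` and `‖A‖_{B(ℓ¹_ν,ℓ¹_ν)} ≤ max(K, δ)`" (column bounds).
  - §5.2, (5.13), p. 1453: "`DT(ā + b)c = [I − ADF(ā + b)]c = [I − AA†]c − A[DF(ā + b)c − A†c]`"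
    and, same page, "`[DF(ā + b)c − A†c]_k = μ_k c_k − 3[(ā + b)² c]_k − …`" — the derivative of a
    convolution power acts by convolution with the lower power (here: of the square, `x̄ ⋆ h + h ⋆ x̄`).

* The kernel product `kmul κ` and the kernel bound `KerBound ω κ C` are the notions of
  `…WeightedEllOneSequenceAlgebra` (certnum-ode-2), where they carry [Kaniuth2009, §1.3
  Def 1.3.1] (weighted convolution algebras) — referenced here, not restated.

## What is formalised (all PROVED; general index `ι`, positive weight `ω`, any kernel `κ` with
## `KerBound ω κ C` — e.g. `convKer` (Cauchy product), the cosine/sine kernels, `prodKer`)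

`kmulKer κ c` and `colBound_kmulKer` (multiplication by `c` = kernel operator, column bound
`C ‖c‖_ω`), `apply_kmulKer` (`= kmul κ c`), `kmulKer_add/smul`, `apply_add_ker/apply_smul_ker`,
`kmulCLM` (`ℓ¹(ι, ℝ) →L[ℝ] ℓ¹(ι, ℝ) →L[ℝ] ℓ¹(ι, ℝ)`, `ofEll1 (kmulCLM x y) = kmul κ (ofEll1 x)
(ofEll1 y)`), `opNorm_kmulCLM_le` (`≤ C`), `hasFDerivAt_kmulCLM_sq`, `opNorm_kmulCLM_sub_le` /
`opNorm_kmulCLM_flip_sub_le` (each slot `C`-Lipschitz), `opNorm_deriv_sq_sub_le` (`‖D(b) − D(x̄)‖ ≤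
2C‖b − x̄‖`, the `Z₂` shape).

## What is NOT covered

No float/interval model; the symmetric-kernel simplification `x̄ ⋆ h + h ⋆ x̄ = 2 x̄ ⋆ h` is left
to the client (true for `convKer`/cosine kernels, not assumed here); higher powers by iterating.
-/

noncomputable section

open scoped lp

namespace Literature.Analysis.ValidatedNumerics.WeightedSeq

variable {ι : Type*} {ω : ι → ℝ}

/-- [folklore] -/
private theorem ofReal_abs_tsum_le' {α : Type*} (f : α → ℝ) :
    ENNReal.ofReal |∑' i, f i| ≤ ∑' i, ENNReal.ofReal |f i| := by
  by_cases hf : Summable f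
  · have habs : Summable fun i => |f i| := hf.abs
    calc ENNReal.ofReal |∑' i, f i| ≤ ENNReal.ofReal (∑' i, |f i|) := by
          apply ENNReal.ofReal_le_ofReal
          have h := norm_tsum_le_tsum_norm (f := f) (by simpa [Real.norm_eq_abs] using habs)
          simpa [Real.norm_eq_abs] using h
      _ = ∑' i, ENNReal.ofReal |f i| :=
          ENNReal.ofReal_tsum_of_nonneg (fun i => abs_nonneg _) habs
  · simp [tsum_eq_zero_of_not_summable hf]

/-- Kernel of the multiplication operator `h ↦ c ⋆_κ h`: `kmulKer κ c n m = Σ_l κ(l,m,n) c_l`.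
[cite: HungriaLessardMirelesJames2016, §2.1 p. 1433 (ℓ¹_ν is a Banach algebra)] -/
def kmulKer (κ : ι → ι → ι → ℝ) (c : ι → ℝ) (n m : ι) : ℝ := ∑' l, κ l m n * c l

/-- **Multiplication operators are kernel operators with column bound `C ‖c‖_ω`.**
[cite: HungriaLessardMirelesJames2016, §2.1 p. 1433 (‖a ∗ b‖_ν ≤ ‖a‖_ν‖b‖_ν) and Cor. 1 p. 1434] -/
theorem colBound_kmulKer (hω : ∀ i, 0 < ω i) {κ : ι → ι → ι → ℝ} {C : ℝ} (hC : 0 ≤ C)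
    (hκ : KerBound ω κ C) {c : ι → ℝ} (hc : Mem ω c) :
    ColBound ω ω (kmulKer κ c) (C * wnorm ω c) := by
  intro m
  have hω0 : ∀ i, 0 ≤ ω i := fun i => (hω i).le
  have h1 : ∀ n, ENNReal.ofReal (|kmulKer κ c n m| * ω n) ≤
      ∑' l, ENNReal.ofReal |c l| * ENNReal.ofReal (|κ l m n| * ω n) := by
    intro n
    have e1 : |kmulKer κ c n m| * ω n = |∑' l, κ l m n * c l * ω n| := by
      rw [kmulKer, ← abs_of_nonneg (hω0 n), ← abs_mul, abs_of_nonneg (hω0 n), ← tsum_mul_right]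
    rw [e1]
    refine (ofReal_abs_tsum_le' _).trans (ENNReal.tsum_le_tsum fun l => le_of_eq ?_)
    rw [← ENNReal.ofReal_mul (abs_nonneg _), abs_mul, abs_mul, abs_of_nonneg (hω0 n)]
    congr 1; ring
  have hew : (∑' l, ENNReal.ofReal (|c l| * ω l)) = ENNReal.ofReal (wnorm ω c) :=
    (ENNReal.ofReal_tsum_of_nonneg (fun l => mul_nonneg (abs_nonneg _) (hω0 l)) hc).symm
  calc (∑' n, ENNReal.ofReal (|kmulKer κ c n m| * ω n))
      ≤ ∑' n, ∑' l, ENNReal.ofReal |c l| * ENNReal.ofReal (|κ l m n| * ω n) :=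
        ENNReal.tsum_le_tsum h1
    _ = ∑' l, ∑' n, ENNReal.ofReal |c l| * ENNReal.ofReal (|κ l m n| * ω n) := ENNReal.tsum_comm
    _ = ∑' l, ENNReal.ofReal |c l| * ∑' n, ENNReal.ofReal (|κ l m n| * ω n) :=
        tsum_congr fun l => ENNReal.tsum_mul_left
    _ ≤ ∑' l, ENNReal.ofReal |c l| * ENNReal.ofReal (C * (ω l * ω m)) :=
        ENNReal.tsum_le_tsum fun l => mul_le_mul' le_rfl (hκ l m)
    _ = ∑' l, ENNReal.ofReal (C * ω m) * ENNReal.ofReal (|c l| * ω l) := by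
        refine tsum_congr fun l => ?_
        rw [← ENNReal.ofReal_mul (abs_nonneg _),
          ← ENNReal.ofReal_mul (mul_nonneg hC (hω0 m))]
        congr 1; ring
    _ = ENNReal.ofReal (C * ω m) * ENNReal.ofReal (wnorm ω c) := by
        rw [ENNReal.tsum_mul_left, hew]
    _ = ENNReal.ofReal (C * wnorm ω c * ω m) := by
        rw [← ENNReal.ofReal_mul (mul_nonneg hC (hω0 m))]
        congr 1; ring

/-- The multiplication operator IS the kernel product: `T_{kmulKer κ c} h = c ⋆_κ h` on `ℓ¹_ω`.
[cite: HungriaLessardMirelesJames2016, §2.1 p. 1433] -/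
theorem apply_kmulKer (hω : ∀ i, 0 < ω i) {κ : ι → ι → ι → ℝ} {C : ℝ} (hC : 0 ≤ C)
    (hκ : KerBound ω κ C) {c h : ι → ℝ} (hc : Mem ω c) (hh : Mem ω h) :
    apply (kmulKer κ c) h = kmul κ c h := by
  funext n
  have hs : Summable fun p : ι × ι => c p.1 * h p.2 * κ p.1 p.2 n :=
    summable_kmul_term hω hC hκ hc hh n
  unfold apply kmulKer kmul
  have e1 : (fun m => (∑' l, κ l m n * c l) * h m) = fun m => ∑' l, c l * h m * κ l m n := by
    funext m
    rw [← tsum_mul_right]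
    exact tsum_congr fun l => by ring
  rw [e1]
  have hu : Summable (Function.uncurry fun l m => c l * h m * κ l m n) := hs
  rw [hu.tsum_comm]
  exact hs.tsum_prod.symm

/-- Fibre summability of the multiplication kernel. [cite: HungriaLessardMirelesJames2016, §2.1 p. 1433] -/
theorem summable_kmulKer_term (hω : ∀ i, 0 < ω i) {κ : ι → ι → ι → ℝ} {C : ℝ} (hC : 0 ≤ C)
    (hκ : KerBound ω κ C) {c : ι → ℝ} (hc : Mem ω c) (n m : ι) :
    Summable fun l => κ l m n * c l := by
  have hω0 : ∀ i, 0 ≤ ω i := fun i => (hω i).le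
  refine Summable.of_norm_bounded (hc.mul_left (C * ω m / ω n)) fun l => ?_
  have hk : |κ l m n| * ω n ≤ C * (ω l * ω m) := abs_ker_mul_weight_le hω0 hC hκ l m n
  rw [Real.norm_eq_abs, abs_mul, div_mul_eq_mul_div, le_div_iff₀ (hω n)]
  calc |κ l m n| * |c l| * ω n = (|κ l m n| * ω n) * |c l| := by ring
    _ ≤ C * (ω l * ω m) * |c l| := mul_le_mul_of_nonneg_right hk (abs_nonneg _)
    _ = C * ω m * (|c l| * ω l) := by ring

/-- The multiplication kernel is additive in the multiplier. [cite: HungriaLessardMirelesJames2016, §2.1 p. 1433] -/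
theorem kmulKer_add (hω : ∀ i, 0 < ω i) {κ : ι → ι → ι → ℝ} {C : ℝ} (hC : 0 ≤ C)
    (hκ : KerBound ω κ C) {a b : ι → ℝ} (ha : Mem ω a) (hb : Mem ω b) :
    kmulKer κ (a + b) = kmulKer κ a + kmulKer κ b := by
  funext n m
  simp only [kmulKer, Pi.add_apply]
  rw [← (summable_kmulKer_term hω hC hκ ha n m).tsum_add (summable_kmulKer_term hω hC hκ hb n m)]
  exact tsum_congr fun l => by ring

/-- The multiplication kernel is homogeneous in the multiplier. [cite: HungriaLessardMirelesJames2016, §2.1 p. 1433] -/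
theorem kmulKer_smul (κ : ι → ι → ι → ℝ) (r : ℝ) (c : ι → ℝ) :
    kmulKer κ (r • c) = r • kmulKer κ c := by
  funext n m
  simp only [kmulKer, Pi.smul_apply, smul_eq_mul]
  rw [← tsum_mul_left]
  exact tsum_congr fun l => by ring

/-- `apply` is additive in the kernel (under row summability). [cite: HungriaLessardMirelesJames2016, Cor. 1 p. 1434] -/
theorem apply_add_ker {ι' : Type*} (M N : ι' → ι → ℝ) (s : ι → ℝ)
    (hM : ∀ k, Summable fun m => M k m * s m) (hN : ∀ k, Summable fun m => N k m * s m) :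
    apply (M + N) s = apply M s + apply N s := by
  funext k
  simp only [apply, Pi.add_apply]
  rw [← (hM k).tsum_add (hN k)]
  exact tsum_congr fun m => by ring

/-- `apply` is homogeneous in the kernel. [cite: HungriaLessardMirelesJames2016, Cor. 1 p. 1434] -/
theorem apply_smul_ker {ι' : Type*} (r : ℝ) (M : ι' → ι → ℝ) (s : ι → ℝ) :
    apply (r • M) s = r • apply M s := by
  funext k
  simp only [apply, Pi.smul_apply, smul_eq_mul]
  rw [← tsum_mul_left]
  exact tsum_congr fun m => by ring

/-- **The kernel product as a bounded bilinear map on `ℓ¹(ι, ℝ)`** (weighted coordinates):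
`(x, y) ↦ toEll1 ω (T_{kmulKer κ (ofEll1 x)} (ofEll1 y)) = toEll1 ω (ofEll1 x ⋆_κ ofEll1 y)`.
[cite: HungriaLessardMirelesJames2016, §2.1 p. 1433 (ℓ¹_ν is a Banach algebra, ‖a ∗ b‖_ν ≤ ‖a‖_ν‖b‖_ν)] -/
def kmulCLM (hω : ∀ i, 0 < ω i) {κ : ι → ι → ι → ℝ} {C : ℝ} (hC : 0 ≤ C) (hκ : KerBound ω κ C) :
    ℓ¹(ι, ℝ) →L[ℝ] ℓ¹(ι, ℝ) →L[ℝ] ℓ¹(ι, ℝ) :=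
  LinearMap.mkContinuous₂
    (LinearMap.mk₂ ℝ
      (fun x y => toEll1 ω (apply (kmulKer κ (ofEll1 ω x)) (ofEll1 ω y)))
      (fun x₁ x₂ y => by
        have h1 := mem_ofEll1 hω x₁
        have h2 := mem_ofEll1 hω x₂
        have hy := mem_ofEll1 hω y
        have hω0 : ∀ i, 0 ≤ ω i := fun i => (hω i).le
        have c1 := colBound_kmulKer hω hC hκ h1
        have c2 := colBound_kmulKer hω hC hκ h2
        rw [ofEll1_add, kmulKer_add hω hC hκ h1 h2,
          apply_add_ker _ _ _
            (summable_apply_row hω0 hω (mul_nonneg hC (wnorm_nonneg hω0 _)) c1 hy)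
            (summable_apply_row hω0 hω (mul_nonneg hC (wnorm_nonneg hω0 _)) c2 hy),
          toEll1_add hω
            (wnorm_apply_le hω0 hω0 (mul_nonneg hC (wnorm_nonneg hω0 _)) c1 hy).1
            (wnorm_apply_le hω0 hω0 (mul_nonneg hC (wnorm_nonneg hω0 _)) c2 hy).1])
      (fun r x y => by
        have hx := mem_ofEll1 hω x
        have hy := mem_ofEll1 hω y
        have hω0 : ∀ i, 0 ≤ ω i := fun i => (hω i).le
        rw [ofEll1_smul, kmulKer_smul, apply_smul_ker,
          toEll1_smul hω r
            (wnorm_apply_le hω0 hω0 (mul_nonneg hC (wnorm_nonneg hω0 _))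
              (colBound_kmulKer hω hC hκ hx) hy).1])
      (fun x y₁ y₂ => by
        have hx := mem_ofEll1 hω x
        have h1 := mem_ofEll1 hω y₁
        have h2 := mem_ofEll1 hω y₂
        have hω0 : ∀ i, 0 ≤ ω i := fun i => (hω i).le
        have cx := colBound_kmulKer hω hC hκ hx
        have hC' : 0 ≤ C * wnorm ω (ofEll1 ω x) := mul_nonneg hC (wnorm_nonneg hω0 _)
        rw [ofEll1_add, apply_add hω0 hω hC' cx h1 h2,
          toEll1_add hω (wnorm_apply_le hω0 hω0 hC' cx h1).1 (wnorm_apply_le hω0 hω0 hC' cx h2).1])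
      (fun r x y => by
        have hx := mem_ofEll1 hω x
        have hy := mem_ofEll1 hω y
        have hω0 : ∀ i, 0 ≤ ω i := fun i => (hω i).le
        have cx := colBound_kmulKer hω hC hκ hx
        have hC' : 0 ≤ C * wnorm ω (ofEll1 ω x) := mul_nonneg hC (wnorm_nonneg hω0 _)
        rw [ofEll1_smul, apply_smul, toEll1_smul hω r (wnorm_apply_le hω0 hω0 hC' cx hy).1]))
    C
    (fun x y => by
      have hx := mem_ofEll1 hω x
      have hy := mem_ofEll1 hω y
      have hω0 : ∀ i, 0 ≤ ω i := fun i => (hω i).le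
      have cx := colBound_kmulKer hω hC hκ hx
      have hC' : 0 ≤ C * wnorm ω (ofEll1 ω x) := mul_nonneg hC (wnorm_nonneg hω0 _)
      obtain ⟨hm, hle⟩ := wnorm_apply_le hω0 hω0 hC' cx hy
      simp only [LinearMap.mk₂_apply]
      rw [norm_toEll1 hω hm, ← wnorm_ofEll1 hω x, ← wnorm_ofEll1 hω y]
      exact hle)

/-- In weighted coordinates `kmulCLM` is the kernel product `kmul κ`.
[cite: HungriaLessardMirelesJames2016, §2.1 p. 1433] -/
theorem ofEll1_kmulCLM (hω : ∀ i, 0 < ω i) {κ : ι → ι → ι → ℝ} {C : ℝ} (hC : 0 ≤ C)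
    (hκ : KerBound ω κ C) (x y : ℓ¹(ι, ℝ)) :
    ofEll1 ω (kmulCLM hω hC hκ x y) = kmul κ (ofEll1 ω x) (ofEll1 ω y) := by
  have hx := mem_ofEll1 hω x
  have hy := mem_ofEll1 hω y
  have hω0 : ∀ i, 0 ≤ ω i := fun i => (hω i).le
  have hm := (wnorm_apply_le hω0 hω0 (mul_nonneg hC (wnorm_nonneg hω0 _))
    (colBound_kmulKer hω hC hκ hx) hy).1
  simp only [kmulCLM, LinearMap.mkContinuous₂_apply, LinearMap.mk₂_apply]
  rw [ofEll1_toEll1 hω hm, apply_kmulKer hω hC hκ hx hy]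

/-- **Banach-algebra constant as a bilinear operator norm**: `‖(x, y) ↦ x ⋆_κ y‖ ≤ C`.
[cite: HungriaLessardMirelesJames2016, §2.1 p. 1433 (‖a ∗ b‖_ν ≤ ‖a‖_ν‖b‖_ν)] -/
theorem opNorm_kmulCLM_le (hω : ∀ i, 0 < ω i) {κ : ι → ι → ι → ℝ} {C : ℝ} (hC : 0 ≤ C)
    (hκ : KerBound ω κ C) : ‖kmulCLM hω hC hκ‖ ≤ C := by
  unfold kmulCLM
  exact LinearMap.mkContinuous₂_norm_le _ hC _

/-- **Fréchet derivative of the quadratic map** `x ↦ x ⋆_κ x` on `ℓ¹(ι, ℝ)`: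
`h ↦ x̄ ⋆ h + h ⋆ x̄`. [cite: HungriaLessardMirelesJames2016, §5.2 (5.13) p. 1453 (DF(ā+b)c = μc − 3(ā+b)²∗c: the derivative of a convolution power)] -/
theorem hasFDerivAt_kmulCLM_sq (hω : ∀ i, 0 < ω i) {κ : ι → ι → ι → ℝ} {C : ℝ} (hC : 0 ≤ C)
    (hκ : KerBound ω κ C) (xbar : ℓ¹(ι, ℝ)) :
    HasFDerivAt (fun x => kmulCLM hω hC hκ x x)
      (kmulCLM hω hC hκ xbar + (kmulCLM hω hC hκ).flip xbar) xbar := by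
  have h := (kmulCLM hω hC hκ).hasFDerivAt_of_bilinear (hasFDerivAt_id xbar) (hasFDerivAt_id xbar)
  refine h.congr_fderiv ?_
  ext v
  simp [ContinuousLinearMap.precompR_apply, ContinuousLinearMap.precompL_apply,
    ContinuousLinearMap.flip_apply]

/-- **Lipschitz bound of the derivative** (the `Z₂`-type estimate): `‖B b − B x̄‖ ≤ C ‖b − x̄‖`.
[cite: HungriaLessardMirelesJames2016, §5.2 p. 1453 (Z-bounds from the Banach algebra)] -/
theorem opNorm_kmulCLM_sub_le (hω : ∀ i, 0 < ω i) {κ : ι → ι → ι → ℝ} {C : ℝ} (hC : 0 ≤ C)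
    (hκ : KerBound ω κ C) (b xbar : ℓ¹(ι, ℝ)) :
    ‖kmulCLM hω hC hκ b - kmulCLM hω hC hκ xbar‖ ≤ C * ‖b - xbar‖ := by
  rw [← map_sub]
  calc ‖kmulCLM hω hC hκ (b - xbar)‖ ≤ ‖kmulCLM hω hC hκ‖ * ‖b - xbar‖ :=
        ContinuousLinearMap.le_opNorm _ _
    _ ≤ C * ‖b - xbar‖ :=
        mul_le_mul_of_nonneg_right (opNorm_kmulCLM_le hω hC hκ) (norm_nonneg _)

/-- The same Lipschitz bound for the second slot (`‖B.flip‖ = ‖B‖`).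
[cite: HungriaLessardMirelesJames2016, §5.2 p. 1453 (Z-bounds from the Banach algebra)] -/
theorem opNorm_kmulCLM_flip_sub_le (hω : ∀ i, 0 < ω i) {κ : ι → ι → ι → ℝ} {C : ℝ} (hC : 0 ≤ C)
    (hκ : KerBound ω κ C) (b xbar : ℓ¹(ι, ℝ)) :
    ‖(kmulCLM hω hC hκ).flip b - (kmulCLM hω hC hκ).flip xbar‖ ≤ C * ‖b - xbar‖ := by
  rw [← map_sub]
  calc ‖(kmulCLM hω hC hκ).flip (b - xbar)‖ ≤ ‖(kmulCLM hω hC hκ).flip‖ * ‖b - xbar‖ :=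
        ContinuousLinearMap.le_opNorm _ _
    _ ≤ C * ‖b - xbar‖ := by
        rw [ContinuousLinearMap.opNorm_flip]
        exact mul_le_mul_of_nonneg_right (opNorm_kmulCLM_le hω hC hκ) (norm_nonneg _)

/-- **`Z₂`-type bound for the derivative of the quadratic map**: with `D(x) := B x + B.flip x`
(the derivative of `x ↦ x ⋆_κ x` at `x`, `hasFDerivAt_kmulCLM_sq`),
`‖D(b) − D(x̄)‖ ≤ 2C ‖b − x̄‖`. [cite: HungriaLessardMirelesJames2016, §5.2 p. 1453 (Z-bounds from the Banach algebra)] -/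
theorem opNorm_deriv_sq_sub_le (hω : ∀ i, 0 < ω i) {κ : ι → ι → ι → ℝ} {C : ℝ} (hC : 0 ≤ C)
    (hκ : KerBound ω κ C) (b xbar : ℓ¹(ι, ℝ)) :
    ‖(kmulCLM hω hC hκ b + (kmulCLM hω hC hκ).flip b) -
        (kmulCLM hω hC hκ xbar + (kmulCLM hω hC hκ).flip xbar)‖ ≤ 2 * C * ‖b - xbar‖ := by
  have h1 := opNorm_kmulCLM_sub_le hω hC hκ b xbar
  have h2 := opNorm_kmulCLM_flip_sub_le hω hC hκ b xbar
  calc ‖(kmulCLM hω hC hκ b + (kmulCLM hω hC hκ).flip b) -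
        (kmulCLM hω hC hκ xbar + (kmulCLM hω hC hκ).flip xbar)‖
      = ‖(kmulCLM hω hC hκ b - kmulCLM hω hC hκ xbar) +
          ((kmulCLM hω hC hκ).flip b - (kmulCLM hω hC hκ).flip xbar)‖ := by
        congr 1; abel
    _ ≤ ‖kmulCLM hω hC hκ b - kmulCLM hω hC hκ xbar‖ +
          ‖(kmulCLM hω hC hκ).flip b - (kmulCLM hω hC hκ).flip xbar‖ := norm_add_le _ _
    _ ≤ C * ‖b - xbar‖ + C * ‖b - xbar‖ := add_le_add h1 h2
    _ = 2 * C * ‖b - xbar‖ := by ring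

end Literature.Analysis.ValidatedNumerics.WeightedSeq

end
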